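import Summits.AtomisticToContinuum.Crystallization.Theses.FreeSplittingCertificates
import Summits.AtomisticToContinuum.Crystallization.Theorems.ChargedEnergyGap.Negative.BlocksBound
import Literature.MathematicalPhysics.StatisticalMechanics.LennardJonesThermodynamicLimitProofs

/-!
# Route FreeSplittingCertificates — item `PeriodicUpperBound` (stmt-AtomisticToContinuum-12565)

The trial-state upper bound for the Lennard-Jones ground-state energy per particle in `ℝ³`, in
the Fekete normal form used by the route:

  `⨅_{M : ℕ} E(M+1)/(M+1) ≤ e_LJ(Q)` for every periodic configuration `Q` of `ℝ³`.

Proof.  Both ingredients are already in the tree: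

* `BlancLewin2015_8_holds` (`LennardJonesThermodynamicLimitProofs.lean`): the thermodynamic limit
  `e_∞ = lim_{N → ∞} E(N)/N` exists in `d = 3` and `e_∞ ≤ E(N)/N` for every `N ≥ 1`
  (stability + subadditivity + Fekete);
* `ChargedEnergyGapNegative.le_energyPerParticle_of_tendsto`
  (`Theorems/ChargedEnergyGap/Negative/BlocksBound.lean`): if `E(N)/N → e` then `e ≤ e(Q)` for
  every periodic `Q` (blocks of `Q` are injective finite trial states whose boundary and tail
  losses are `o(#block)`).

Since `e_∞` is a lower bound of `M ↦ E(M+1)/(M+1)` and this sequence tends to `e_∞`, the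
conditionally complete infimum `⨅_M E(M+1)/(M+1)` is at most (in fact equal to) `e_∞ ≤ e(Q)`.
[folklore; Blanc–Lewin 2015 = arXiv:1504.01153, §1.3 (8) and §2]
-/

noncomputable section

namespace Summit.AtomisticToContinuum.Crystallization.Theorems

open Literature.MathematicalPhysics.StatisticalMechanics
open Summit.AtomisticToContinuum.Crystallization.Theorems.ChargedEnergyGapNegative
open Filter Topology

/-- The Fekete infimum `⨅_M E(M+1)/(M+1)` of the Lennard-Jones ground-state energy per particle
in `ℝ³` is at most the thermodynamic limit: if `E(N)/N → e` then `⨅_M E(M+1)/(M+1) ≤ e`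
(the shifted sequence tends to `e` and is bounded below by `e`, by `BlancLewin2015_8_holds` and
uniqueness of limits). [folklore] -/
theorem iInf_groundStateEnergy_div_le_of_tendsto {e : ℝ}
    (htend : Tendsto (fun N : ℕ => groundStateEnergy lennardJones 3 N / N) atTop (𝓝 e)) :
    (⨅ M : ℕ, groundStateEnergy lennardJones 3 (M + 1) / ((M + 1 : ℕ) : ℝ)) ≤ e := by
  obtain ⟨e', -, htend', hle'⟩ := BlancLewin2015_8_holds 3 (by norm_num) (by norm_num)
  have hee' : e = e' := tendsto_nhds_unique htend htend'
  subst hee'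
  have hbdd : BddBelow
      (Set.range fun M : ℕ => groundStateEnergy lennardJones 3 (M + 1) / ((M + 1 : ℕ) : ℝ)) :=
    ⟨e, by rintro _ ⟨M, rfl⟩; exact hle' (M + 1) M.succ_pos⟩
  have hshift : Tendsto (fun M : ℕ => groundStateEnergy lennardJones 3 (M + 1) / ((M + 1 : ℕ) : ℝ))
      atTop (𝓝 e) :=
    htend.comp (tendsto_add_atTop_nat 1)
  exact ge_of_tendsto hshift (Eventually.of_forall fun M => ciInf_le hbdd M)

/-- **Item `PeriodicUpperBound`** (stmt-AtomisticToContinuum-12565, route FreeSplittingCertificates):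
`⨅_{M} E_LJ(M+1)/(M+1) ≤ e_LJ(Q)` for every periodic configuration `Q` of `ℝ³` — every periodic
configuration's energy per particle bounds Fekete's constant `e_∞ = inf_{N ≥ 1} E(N)/N` from above
(trial states = large blocks of `Q`; thermodynamic limit `BlancLewin2015_8_holds`; block bound
`le_energyPerParticle_of_tendsto`). [folklore; Blanc–Lewin 2015, §1.3 (8), §2] -/
theorem periodicUpperBound_proof :
    Summit.AtomisticToContinuum.Crystallization.Theses.FreeSplittingCertificates.PeriodicUpperBound := by
  unfold Summit.AtomisticToContinuum.Crystallization.Theses.FreeSplittingCertificates.PeriodicUpperBound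
  intro Q
  obtain ⟨e, -, htend, -⟩ := BlancLewin2015_8_holds 3 (by norm_num) (by norm_num)
  exact (iInf_groundStateEnergy_div_le_of_tendsto htend).trans
    (le_energyPerParticle_of_tendsto htend Q)

end Summit.AtomisticToContinuum.Crystallization.Theorems

end
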